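import Mathlib
import HarnessLib
import Literature.MathematicalPhysics.QuantumFieldTheory.LatticeGaugeStaticPotentialProofs
import Literature.MathematicalPhysics.QuantumFieldTheory.WilsonSiteRPForm
import Summits.QuantumFields.YangMills.Theorems.LangevinControlUVFemtoCurvatureTwoPointMirrorPairs

/-!
# Crux `FemtoCurvatureTwoPoint` (stmt-QuantumFields-9363, route `LangevinControlUV`):
# stub RPCS — reflection Cauchy–Schwarz for products of cell observables, helpers

Helper for the line `generic-step-gamma-encoding` (`--supports stmt-QuantumFields-9363`), first of
two files closing the registered stub `stub_plaquetteProductRPCS` (the reflection-positivity input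
of the chessboard estimate for the `01`-plaquette field on even tori); registered sub-goal of this
file: `stub_transportedSiteRP`. Three model-independent layers.

* **Abstract product Cauchy–Schwarz** (`prod_rp_cauchySchwarz`): for a measurable measure-preserving
  involution `Θ` of a finite measure space, reflection positive on a cone `D` of observables
  (`∫ H(Θω) H(ω) ≥ 0`), an involution `θ` of an index set exchanging two complementary halves
  `H₊`, `H₋`, and bounded measurable cell observables `g(ω, x)` with `g(Θω, x) = g(ω, θx)` whose
  products over subsets of `H₊` lie in `D`, the set function `ψ(S) = ∫ ∏_{x ∈ S} g(ω, x)` satisfies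
  `ψ(S)² ≤ ψ((S ∩ H₊) ∪ θ(S ∩ H₊)) · ψ((S ∩ H₋) ∪ θ(S ∩ H₋))` (Fröhlich–Israel–Lieb–Simon 1978,
  proof of Thm. 2.2; Friedli–Velenik Thm. 10.11: `∏_S = A · (B ∘ Θ)` with `A = ∏_{S ∩ H₊}`,
  `B = ∏_{θ(S ∩ H₋)}`, then the discriminant Cauchy–Schwarz inequality of the positive semidefinite
  symmetric form `(H, K) ↦ ∫ H(Θω) K(ω)`, tree `RPCauchySchwarz.sq_integral_le`).
* **Transported reflection positivity of Wilson's lattice gauge measure** on an even torus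
  `(ℤ/L)^d`: the link reflection `Θ₀ = GaugeConfig.timeReflect` (`θ t = 1 − t`, `β ≥ 0`, tree
  `wilsonExpectation_reflectionPositive_holds`) and the site reflection
  `Θ₀' = GaugeConfig.negReflect` (`θ' t = −t`, any `β`, tree
  `wilsonExpectation_siteReflectionPositive`) transported to the axis `π 0` and an arbitrary
  hyperplane by `Φ = τ_v ∘ π_*` (`torusConfigShift`, `configPerm`): `Θ = Φ ∘ Θ₀ ∘ Φ⁻¹` is a
  measurable measure-preserving involution, reflection
  positive in the real uncentred form `0 ≤ ∫ F(ΘU) F(U) dμ_β` on bounded measurable `F` depending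
  only on the links `e` whose pull-back `(sitePerm π⁻¹ (e.1 − v), π⁻¹ e.2)` is a positive link of
  the tree's reflection (`integral_linkTheta_mul_nonneg`, `integral_siteTheta_mul_nonneg`).
* **Plaquette bookkeeping**: the link reflection reflects the base point of spatial plaquette
  holonomies; the site reflection acts on `Re tr` of temporal plaquette holonomies by
  `y ↦ θ'(y + e₀)`; `Re tr ρ(U_{(x;a,b)})` is symmetric in `(a, b)`.
-/

noncomputable section

open MeasureTheory
open Literature.MathematicalPhysics.QuantumFieldTheory

namespace Summit.QuantumFields.YangMills.Theorems.FemtoCurvatureTwoPoint.PlaquetteProductRPCS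

/-! ## Abstract layer: reflection Cauchy–Schwarz for products of cell observables -/

section Abstract

variable {Ω ι : Type*} [MeasurableSpace Ω] {μ : Measure Ω} {Θ : Ω → Ω} [DecidableEq ι]

omit [MeasurableSpace Ω] [DecidableEq ι] in
/-- A product of functions bounded by `C` in absolute value is bounded by `C ^ #T`. [folklore] -/
theorem abs_prod_le_pow {T : Finset ι} {h : ι → ℝ} {C : ℝ} (hC : ∀ x, |h x| ≤ C) :
    |∏ x ∈ T, h x| ≤ C ^ T.card := by
  rw [Finset.abs_prod, ← Finset.prod_const]
  exact Finset.prod_le_prod (fun x _ => abs_nonneg _) fun x _ => hC x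

/-- **Reflection Cauchy–Schwarz for products of cell observables** (the reflection-positivity step
of the chessboard estimate, Fröhlich–Israel–Lieb–Simon 1978 / Friedli–Velenik Thm. 10.11). For a
measurable measure-preserving involution `Θ`, reflection positive on a cone `D` closed under
`H + tK`, an involution `θ` of the index set exchanging the complementary halves `H₊`, `H₋`, and
bounded measurable cell observables with `g(Θω, x) = g(ω, θx)` whose products over subsets of `H₊`
lie in `D`: `ψ(S)² ≤ ψ((S ∩ H₊) ∪ θ(S ∩ H₊)) ψ((S ∩ H₋) ∪ θ(S ∩ H₋))` for
`ψ(S) = ∫ ∏_{x∈S} g(ω, x) dμ`. [folklore] -/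
theorem prod_rp_cauchySchwarz [IsFiniteMeasure μ] (hΘm : Measurable Θ) (hΘμ : μ.map Θ = μ)
    (hΘΘ : ∀ ω, Θ (Θ ω) = ω) {D : (Ω → ℝ) → Prop}
    (hRP : ∀ H : Ω → ℝ, Measurable H → (∃ C : ℝ, ∀ ω, |H ω| ≤ C) → D H →
      0 ≤ ∫ ω, H (Θ ω) * H ω ∂μ)
    (hD : ∀ (H K : Ω → ℝ) (t : ℝ), D H → D K → D fun ω => H ω + t * K ω)
    (θ : ι → ι) (hθθ : ∀ x, θ (θ x) = x) (Hp Hm : Finset ι) (hdisj : Disjoint Hp Hm)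
    (hcover : ∀ x, x ∈ Hp ∨ x ∈ Hm) (hθp : ∀ x ∈ Hp, θ x ∈ Hm) (hθm : ∀ x ∈ Hm, θ x ∈ Hp)
    (g : Ω → ι → ℝ) (hgm : ∀ x, Measurable fun ω => g ω x) {C : ℝ} (hgb : ∀ ω x, |g ω x| ≤ C)
    (hgΘ : ∀ ω x, g (Θ ω) x = g ω (θ x))
    (hgD : ∀ T : Finset ι, T ⊆ Hp → D fun ω => ∏ x ∈ T, g ω x) (S : Finset ι) :
    (∫ ω, ∏ x ∈ S, g ω x ∂μ) ^ 2 ≤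
      (∫ ω, ∏ x ∈ (S ∩ Hp ∪ (S ∩ Hp).image θ), g ω x ∂μ) *
        ∫ ω, ∏ x ∈ (S ∩ Hm ∪ (S ∩ Hm).image θ), g ω x ∂μ := by
  -- adapted from `Literature.Barriers.CriticalPhenomena.NonGibbs.tExpect_prodBad_sq_le`
  have hθinj : Function.Injective θ := Function.Involutive.injective hθθ
  set Sp := S ∩ Hp with hSp
  set Sm := S ∩ Hm with hSm
  -- products transported by `Θ`
  have hcomp : ∀ (T : Finset ι) (ω : Ω), ∏ x ∈ T, g (Θ ω) x = ∏ x ∈ T.image θ, g ω x := by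
    intro T ω
    rw [Finset.prod_image fun x _ y _ h => hθinj h]
    exact Finset.prod_congr rfl fun x _ => hgΘ ω x
  have himage_image : ∀ T : Finset ι, (T.image θ).image θ = T := by
    intro T
    rw [Finset.image_image, show θ ∘ θ = id from funext hθθ, Finset.image_id]
  -- disjointness of the pieces
  have hdisjS : Disjoint Sp Sm := hdisj.mono Finset.inter_subset_right Finset.inter_subset_right
  have hdisjP : Disjoint Sp (Sp.image θ) := by
    rw [Finset.disjoint_left]
    rintro x hx hx'
    obtain ⟨y, hy, rfl⟩ := Finset.mem_image.1 hx'
    exact Finset.disjoint_left.1 hdisj (Finset.mem_inter.1 hx).2 (hθp _ (Finset.mem_inter.1 hy).2)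
  have hdisjM : Disjoint Sm (Sm.image θ) := by
    rw [Finset.disjoint_left]
    rintro x hx hx'
    obtain ⟨y, hy, rfl⟩ := Finset.mem_image.1 hx'
    exact Finset.disjoint_left.1 hdisj (hθm _ (Finset.mem_inter.1 hy).2) (Finset.mem_inter.1 hx).2
  have hSunion : Sp ∪ Sm = S := by
    rw [hSp, hSm, ← Finset.inter_union_distrib_left]
    exact Finset.inter_eq_left.2 fun x _ => Finset.mem_union.2 (hcover x)
  -- the three identities `B(Θω) A(ω) = ∏_S`, `A(Θω) A(ω) = ∏_{symP}`, `B(Θω) B(ω) = ∏_{symM}`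
  have h1 : ∀ ω, (∏ x ∈ Sm.image θ, g (Θ ω) x) * ∏ x ∈ Sp, g ω x = ∏ x ∈ S, g ω x := by
    intro ω
    rw [hcomp, himage_image, mul_comm, ← Finset.prod_union hdisjS, hSunion]
  have h2 : ∀ ω, (∏ x ∈ Sp, g (Θ ω) x) * ∏ x ∈ Sp, g ω x = ∏ x ∈ Sp ∪ Sp.image θ, g ω x := by
    intro ω
    rw [hcomp, mul_comm, ← Finset.prod_union hdisjP]
  have h3 : ∀ ω, (∏ x ∈ Sm.image θ, g (Θ ω) x) * ∏ x ∈ Sm.image θ, g ω x =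
      ∏ x ∈ Sm ∪ Sm.image θ, g ω x := by
    intro ω
    rw [hcomp, himage_image, ← Finset.prod_union hdisjM]
  -- measurability, bounds, admissibility of `A = ∏_{S₊}` and `B = ∏_{θ S₋}`
  have hAm : Measurable fun ω => ∏ x ∈ Sp, g ω x :=
    Finset.measurable_prod (f := fun x ω => g ω x) Sp fun x _ => hgm x
  have hBm : Measurable fun ω => ∏ x ∈ Sm.image θ, g ω x :=
    Finset.measurable_prod (f := fun x ω => g ω x) _ fun x _ => hgm x
  have hAb : ∃ C' : ℝ, ∀ ω, |∏ x ∈ Sp, g ω x| ≤ C' :=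
    ⟨C ^ Sp.card, fun ω => abs_prod_le_pow fun x => hgb ω x⟩
  have hBb : ∃ C' : ℝ, ∀ ω, |∏ x ∈ Sm.image θ, g ω x| ≤ C' :=
    ⟨C ^ (Sm.image θ).card, fun ω => abs_prod_le_pow fun x => hgb ω x⟩
  have hAD : D fun ω => ∏ x ∈ Sp, g ω x := hgD Sp Finset.inter_subset_right
  have hBD : D fun ω => ∏ x ∈ Sm.image θ, g ω x := by
    refine hgD _ fun x hx => ?_
    obtain ⟨y, hy, rfl⟩ := Finset.mem_image.1 hx
    exact hθm _ (Finset.mem_inter.1 hy).2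
  have key := FiniteSusceptibilityWeakCoupling.RPCauchySchwarz.sq_integral_le hΘm hΘμ hΘΘ hRP hD
    hBm hAm hBb hAb hBD hAD
  simp only [h1, h2, h3] at key
  rw [mul_comm] at key
  exact key

omit [MeasurableSpace Ω] [DecidableEq ι] in
/-- `DependsOn` is closed under finite products. [folklore] -/
theorem dependsOn_finset_prod {κ X : Type*} {s : Set κ} {T : Finset ι} {h : (κ → X) → ι → ℝ}
    (hh : ∀ x ∈ T, DependsOn (fun ω => h ω x) s) :
    DependsOn (fun ω => ∏ x ∈ T, h ω x) s := fun _ _ hUV =>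
  Finset.prod_congr rfl fun x hx => hh x hx hUV

end Abstract

/-! ## Transported reflections `Φ ∘ Θ₀ ∘ Φ⁻¹`, `Φ = τ_v ∘ π_*`, of torus gauge configurations -/

section Transport

variable {d L N : ℕ} [NeZero d] [NeZero L] {G : Type*} [Group G] [TopologicalSpace G]
  [IsTopologicalGroup G] [CompactSpace G] [MeasurableSpace G] [BorelSpace G]
  (ρ : G →* Matrix (Fin N) (Fin N) ℂ)

omit [NeZero L] [TopologicalSpace G] [IsTopologicalGroup G] [CompactSpace G] [BorelSpace G] in
/-- The transported site reflection `τ_v ∘ π_* ∘ Θ₀' ∘ π_*⁻¹ ∘ τ_{−v}` is an involution.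
[folklore] -/
theorem siteTheta_siteTheta (π : Equiv.Perm (Fin d)) (v : Site d L) (U : GaugeConfig d L G) :
    torusConfigShift v (configPerm π (GaugeConfig.negReflect (configPerm π.symm
      (torusConfigShift (-v) (torusConfigShift v (configPerm π (GaugeConfig.negReflect
        (configPerm π.symm (torusConfigShift (-v) U))))))))) = U := by
  rw [FiniteSusceptibilityWeakCoupling.RPCauchySchwarz.torusConfigShift_neg_shift,
    FiniteSusceptibilityWeakCoupling.RPCauchySchwarz.configPerm_symm_configPerm,
    WilsonSiteRP.negReflect_negReflect_config,
    FiniteSusceptibilityWeakCoupling.RPCauchySchwarz.configPerm_configPerm_symm,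
    FiniteSusceptibilityWeakCoupling.RPCauchySchwarz.torusConfigShift_shift_neg]

omit [NeZero L] [CompactSpace G] in
/-- The transported site reflection is measurable. [folklore] -/
theorem measurable_siteTheta (π : Equiv.Perm (Fin d)) (v : Site d L) :
    Measurable fun U : GaugeConfig d L G => torusConfigShift v (configPerm π
      (GaugeConfig.negReflect (configPerm π.symm (torusConfigShift (-v) U)))) :=
  (torusConfigShift v).measurable.comp ((configPerm π).measurable.comp
    (WilsonSiteRP.measurable_negReflect.comp ((configPerm π.symm).measurable.comp
      (torusConfigShift (-v)).measurable)))

/-- The transported site reflection preserves the torus Wilson state (`L` even). [folklore] -/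
theorem map_siteTheta (hL : Even L) (hρ : Continuous ρ) (β : ℝ) (π : Equiv.Perm (Fin d))
    (v : Site d L) :
    (wilsonMeasure (d := d) (L := L) ρ β).map (fun U => torusConfigShift v (configPerm π
      (GaugeConfig.negReflect (configPerm π.symm (torusConfigShift (-v) U))))) =
      wilsonMeasure (d := d) (L := L) ρ β := by
  -- adapted from `FiniteSusceptibilityWeakCoupling.RPCauchySchwarz.map_theta`
  haveI : Fact (1 < L) := ⟨by obtain ⟨r, hr⟩ := hL; have := NeZero.ne L; omega⟩
  have hsh : ∀ w : Site d L, MeasurePreserving (torusConfigShift w)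
      (wilsonMeasure (d := d) (L := L) ρ β) (wilsonMeasure (d := d) (L := L) ρ β) :=
    fun w => ⟨(torusConfigShift w).measurable, wilsonMeasure_map_torusConfigShift ρ β w⟩
  have hcp : ∀ σ : Equiv.Perm (Fin d), MeasurePreserving (configPerm σ)
      (wilsonMeasure (d := d) (L := L) ρ β) (wilsonMeasure (d := d) (L := L) ρ β) :=
    fun σ => ⟨(configPerm σ).measurable, wilsonMeasure_map_configPerm ρ hρ β σ⟩
  have htr : MeasurePreserving GaugeConfig.negReflect
      (wilsonMeasure (d := d) (L := L) ρ β) (wilsonMeasure (d := d) (L := L) ρ β) :=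
    ⟨WilsonSiteRP.measurable_negReflect, WilsonSiteRP.wilsonMeasure_map_negReflect ρ hL hρ β⟩
  exact ((hsh v).comp ((hcp π).comp (htr.comp ((hcp π.symm).comp (hsh (-v)))))).map_eq

omit [NeZero d] in
/-- The composite symmetry `Φ = τ_v ∘ π_*` preserves the torus Wilson measure. [folklore] -/
theorem map_configPerm_trans_torusConfigShift (hρ : Continuous ρ) (β : ℝ) (π : Equiv.Perm (Fin d))
    (v : Site d L) :
    (wilsonMeasure ρ β).map ((configPerm π).trans (torusConfigShift v)) =
      wilsonMeasure (d := d) (L := L) (G := G) ρ β := by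
  -- adapted from `wilsonMeasure_map_configPerm_trans_torusConfigShift` in
  -- `Summit.QuantumFields.YangMills.Theorems.FiniteSusceptibilityWeakCoupling.OddTorusRP`
  rw [MeasurableEquiv.coe_trans,
    ← Measure.map_map (torusConfigShift v).measurable (configPerm π).measurable,
    wilsonMeasure_map_configPerm ρ hρ, wilsonMeasure_map_torusConfigShift]

omit [NeZero d] [NeZero L] [Group G] [TopologicalSpace G] [IsTopologicalGroup G] [CompactSpace G]
  [BorelSpace G] in
/-- An observable depending only on the links whose pull-back by `Φ = τ_v ∘ π_*` lies in a set `Q`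
becomes, after composition with `Φ`, an observable depending only on `Q`. [folklore] -/
theorem dependsOn_comp_phi (π : Equiv.Perm (Fin d)) (v : Site d L) {Q : Set (Edge d L)}
    {F : GaugeConfig d L G → ℝ}
    (hF : DependsOn F {e : Edge d L | ((sitePerm π.symm (e.1 - v), π.symm e.2) : Edge d L) ∈ Q}) :
    DependsOn (fun W : GaugeConfig d L G => F (torusConfigShift v (configPerm π W))) Q := by
  intro W W' hWW'
  refine hF fun e he => ?_
  simp only [torusConfigShift_apply, configPerm_apply]
  exact hWW' _ he

/-- **Transported link reflection positivity** (`L` even, `β ≥ 0`, real uncentred form): for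
bounded measurable real `F` depending only on the links whose pull-back by `Φ = τ_v ∘ π_*` is a
positive-time link, `0 ≤ ∫ F(ΘU) F(U) dμ_β` with `Θ = Φ ∘ Θ₀ ∘ Φ⁻¹`. [folklore] -/
theorem integral_linkTheta_mul_nonneg (hL : Even L) (hρ : Continuous ρ) {β : ℝ} (hβ : 0 ≤ β)
    (π : Equiv.Perm (Fin d)) (v : Site d L) (F : GaugeConfig d L G → ℝ) (hF : Measurable F)
    (hFb : ∃ C : ℝ, ∀ U, |F U| ≤ C)
    (hFdep : DependsOn F {e : Edge d L |
      WilsonRP.IsPosEdge ((sitePerm π.symm (e.1 - v), π.symm e.2) : Edge d L)}) :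
    0 ≤ ∫ U, F (torusConfigShift v (configPerm π (GaugeConfig.timeReflect (configPerm π.symm
      (torusConfigShift (-v) U))))) * F U ∂(wilsonMeasure (d := d) (L := L) ρ β) := by
  -- adapted from `FiniteSusceptibilityWeakCoupling.stub_oddTorusRP`
  obtain ⟨C, hC⟩ := hFb
  have hdep : DependsOn (fun W : GaugeConfig d L G => F (torusConfigShift v (configPerm π W)))
      {e : Edge d L | WilsonRP.IsPosEdge e} := dependsOn_comp_phi π v hFdep
  have hpos : IsPositiveTimeObservable
      (fun W : GaugeConfig d L G => F (torusConfigShift v (configPerm π W))) := by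
    intro W W' hWW'
    exact hdep fun e he => by
      obtain ⟨h1, h2, h3, h4⟩ := he
      exact hWW' e h1 h2 h3 h4
  have h0 : 0 ≤ ∫ W, F (torusConfigShift v (configPerm π (GaugeConfig.timeReflect W))) *
      F (torusConfigShift v (configPerm π W)) ∂(wilsonMeasure (d := d) (L := L) ρ β) :=
    AxisCovNonneg.integral_timeReflect_mul_nonneg_even ρ hL hρ hβ _
      (hF.comp ((torusConfigShift v).measurable.comp (configPerm π).measurable))
      ⟨C, fun W => hC _⟩ hpos
  rw [← map_configPerm_trans_torusConfigShift ρ hρ β π v, integral_map_equiv]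
  refine h0.trans_eq (integral_congr_ae (Filter.Eventually.of_forall fun W => ?_))
  simp only [MeasurableEquiv.trans_apply,
    FiniteSusceptibilityWeakCoupling.RPCauchySchwarz.torusConfigShift_neg_shift,
    FiniteSusceptibilityWeakCoupling.RPCauchySchwarz.configPerm_symm_configPerm]

/-- **Transported site reflection positivity** (`L` even, any `β`, real uncentred form): for
bounded measurable real `F` depending only on the links whose pull-back by `Φ = τ_v ∘ π_*` is a
site-positive or shared link, `0 ≤ ∫ F(Θ'U) F(U) dμ_β` with `Θ' = Φ ∘ Θ₀' ∘ Φ⁻¹`. [folklore] -/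
theorem integral_siteTheta_mul_nonneg (hL : Even L) (hρ : Continuous ρ) (β : ℝ)
    (π : Equiv.Perm (Fin d)) (v : Site d L) (F : GaugeConfig d L G → ℝ) (hF : Measurable F)
    (hFb : ∃ C : ℝ, ∀ U, |F U| ≤ C)
    (hFdep : DependsOn F {e : Edge d L |
      WilsonSiteRP.IsSitePosEdge ((sitePerm π.symm (e.1 - v), π.symm e.2) : Edge d L) ∨
        WilsonSiteRP.IsSharedEdge ((sitePerm π.symm (e.1 - v), π.symm e.2) : Edge d L)}) :
    0 ≤ ∫ U, F (torusConfigShift v (configPerm π (GaugeConfig.negReflect (configPerm π.symm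
      (torusConfigShift (-v) U))))) * F U ∂(wilsonMeasure (d := d) (L := L) ρ β) := by
  -- adapted from `FiniteSusceptibilityWeakCoupling.stub_oddTorusRP`
  obtain ⟨C, hC⟩ := hFb
  have hdep : DependsOn (fun W : GaugeConfig d L G => F (torusConfigShift v (configPerm π W)))
      ((WilsonSiteRP.sitePosEdges ∪ WilsonSiteRP.sharedEdges : Finset (Edge d L)) :
        Set (Edge d L)) := by
    have h := dependsOn_comp_phi π v
      (Q := {e : Edge d L | WilsonSiteRP.IsSitePosEdge e ∨ WilsonSiteRP.IsSharedEdge e}) hFdep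
    intro W W' hWW'
    refine h fun e he => hWW' e ?_
    rw [Finset.coe_union, Set.mem_union, Finset.mem_coe, Finset.mem_coe,
      WilsonSiteRP.mem_sitePosEdges, WilsonSiteRP.mem_sharedEdges]
    exact he
  have h0 : 0 ≤ ∫ W, F (torusConfigShift v (configPerm π (GaugeConfig.negReflect W))) *
      F (torusConfigShift v (configPerm π W)) ∂(wilsonMeasure (d := d) (L := L) ρ β) :=
    AxisCovNonneg.integral_negReflect_mul_nonneg ρ hL hρ β _
      (hF.comp ((torusConfigShift v).measurable.comp (configPerm π).measurable))
      ⟨C, fun W => hC _⟩ hdep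
  rw [← map_configPerm_trans_torusConfigShift ρ hρ β π v, integral_map_equiv]
  refine h0.trans_eq (integral_congr_ae (Filter.Eventually.of_forall fun W => ?_))
  simp only [MeasurableEquiv.trans_apply,
    FiniteSusceptibilityWeakCoupling.RPCauchySchwarz.torusConfigShift_neg_shift,
    FiniteSusceptibilityWeakCoupling.RPCauchySchwarz.configPerm_symm_configPerm]

end Transport

/-! ## Plaquette holonomies under the two reflections -/

section Plaquettes

variable {d L N : ℕ} {G : Type*} [Group G] [TopologicalSpace G] [IsTopologicalGroup G]
  [CompactSpace G] (ρ : G →* Matrix (Fin N) (Fin N) ℂ)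

omit [TopologicalSpace G] [IsTopologicalGroup G] [CompactSpace G] in
/-- The link reflection acts on SPATIAL plaquette holonomies by reflecting the base point.
[folklore] -/
theorem plaquetteHolonomy_timeReflect_of_ne [NeZero d] (U : GaugeConfig d L G) (y : Site d L)
    {a b : Fin d} (ha : a ≠ 0) (hb : b ≠ 0) :
    plaquetteHolonomy U.timeReflect y a b = plaquetteHolonomy U y.timeReflect a b := by
  simp only [plaquetteHolonomy, GaugeConfig.timeReflect, ha, hb, ↓reduceIte,
    WilsonRP.timeReflect_shift_of_ne _ ha, WilsonRP.timeReflect_shift_of_ne _ hb]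

/-- `Re tr ρ(U_{(x;b,a)}) = Re tr ρ(U_{(x;a,b)})` (the two orientations have inverse holonomies).
[folklore] -/
theorem re_tr_plaquetteHolonomy_swap (hρ : Continuous ρ) (U : GaugeConfig d L G) (x : Site d L)
    (a b : Fin d) :
    (ρ (plaquetteHolonomy U x b a)).trace.re = (ρ (plaquetteHolonomy U x a b)).trace.re := by
  rw [plaquetteHolonomy_swap U x a b,
    Literature.RepresentationTheory.CompactGroups.CompactGroup.re_trace_map_inv ρ hρ]

/-- The site reflection acts on `Re tr` of a TEMPORAL plaquette holonomy (plane `(0, b)` or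
`(b, 0)`) by `y ↦ θ'(y + e₀)` on the base point. [folklore] -/
theorem re_tr_plaquetteHolonomy_negReflect_temporal (hρ : Continuous ρ) [NeZero d]
    (U : GaugeConfig d L G) (y : Site d L) {a b : Fin d}
    (hab : (a = 0 ∧ b ≠ 0) ∨ (b = 0 ∧ a ≠ 0)) :
    (ρ (plaquetteHolonomy U.negReflect y a b)).trace.re =
      (ρ (plaquetteHolonomy U (y.shift 0).negReflect a b)).trace.re := by
  -- the case `a = 0 < b` is the tree's `WilsonSiteRP.plaqRe_negReflect`
  have key : ∀ {c : Fin d}, c ≠ 0 → (ρ (plaquetteHolonomy U.negReflect y 0 c)).trace.re =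
      (ρ (plaquetteHolonomy U (y.shift 0).negReflect 0 c)).trace.re := by
    intro c hc
    have hlt : (0 : Fin d) < c := by
      rcases lt_or_eq_of_le (Fin.zero_le c) with h | h
      · exact h
      · exact absurd h.symm hc
    have h := WilsonSiteRP.plaqRe_negReflect ρ hρ U ((y, ⟨((0 : Fin d), c), hlt⟩) : Plaquette d L)
    simpa [WilsonRP.plaqRe, WilsonSiteRP.sitePlaqReflect] using h
  rcases hab with ⟨rfl, hb⟩ | ⟨rfl, ha⟩
  · exact key hb
  · rw [re_tr_plaquetteHolonomy_swap ρ hρ, key ha, ← re_tr_plaquetteHolonomy_swap ρ hρ]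

end Plaquettes

end Summit.QuantumFields.YangMills.Theorems.FemtoCurvatureTwoPoint.PlaquetteProductRPCS

namespace Summit.QuantumFields.YangMills.Theorems.FemtoCurvatureTwoPoint

/-- **Registered sub-goal `stub_transportedSiteRP`** (`--supports stmt-QuantumFields-9363`): site
reflection positivity of Wilson's lattice gauge measure in EVERY axis direction `π 0` and EVERY site
hyperplane `v` of an even torus, real uncentred form, any `β` (closed form of
`PlaquetteProductRPCS.integral_siteTheta_mul_nonneg`, fully qualified): for bounded measurable
real `F` depending only on the links whose pull-back by `Φ = τ_v ∘ π_*` is site-positive or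
shared, `0 ≤ ∫ F(Φ(Θ₀'(Φ⁻¹ U))) F(U) dμ_β`. [folklore] -/
theorem stub_transportedSiteRP : ∀ (d L N : ℕ) [NeZero d] [NeZero L] (G : Type) [Group G] [TopologicalSpace G] [IsTopologicalGroup G] [CompactSpace G] [MeasurableSpace G] [BorelSpace G] (ρ : G →* Matrix (Fin N) (Fin N) ℂ), Continuous ρ → Even L → ∀ (β : ℝ) (π : Equiv.Perm (Fin d)) (v : Literature.MathematicalPhysics.QuantumFieldTheory.Site d L) (F : Literature.MathematicalPhysics.QuantumFieldTheory.GaugeConfig d L G → ℝ), Measurable F → (∃ C : ℝ, ∀ U, |F U| ≤ C) → DependsOn F {e : Literature.MathematicalPhysics.QuantumFieldTheory.Edge d L | Literature.MathematicalPhysics.QuantumFieldTheory.WilsonSiteRP.IsSitePosEdge (Literature.MathematicalPhysics.QuantumFieldTheory.sitePerm π.symm (e.1 - v), π.symm e.2) ∨ Literature.MathematicalPhysics.QuantumFieldTheory.WilsonSiteRP.IsSharedEdge (Literature.MathematicalPhysics.QuantumFieldTheory.sitePerm π.symm (e.1 - v), π.symm e.2)} → 0 ≤ ∫ U, F (Literature.MathematicalPhysics.QuantumFieldTheory.torusConfigShift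 v (Literature.MathematicalPhysics.QuantumFieldTheory.configPerm π (Literature.MathematicalPhysics.QuantumFieldTheory.GaugeConfig.negReflect (Literature.MathematicalPhysics.QuantumFieldTheory.configPerm π.symm (Literature.MathematicalPhysics.QuantumFieldTheory.torusConfigShift (-v) U))))) * F U ∂(Literature.MathematicalPhysics.QuantumFieldTheory.wilsonMeasure ρ β : MeasureTheory.Measure (Literature.MathematicalPhysics.QuantumFieldTheory.GaugeConfig d L G)) := by
  intro d L N _ _ G _ _ _ _ _ _ ρ hρ hL β π v F hF hFb hFdep
  exact PlaquetteProductRPCS.integral_siteTheta_mul_nonneg ρ hL hρ β π v F hF hFb hFdep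

end Summit.QuantumFields.YangMills.Theorems.FemtoCurvatureTwoPoint

end
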